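import Summits.CriticalPhenomena.SAWScalingLimit.Theorems.SAWLeftRightFKGFKGToTraversalBoundSlitNecklaceOutline
import Literature.Probability.LatticeModels.DomainDiscretisation
import HarnessLib

/-!
# Face-chain discretisation, part 1: the local lemma at one point

Crux `SAWLeftRightFKG.FKGToTraversalBound` (stmt-CriticalPhenomena-1878), line `slit-necklace`, lead
prover-line-stmt-CriticalPhenomena-1878-c5-0; wave 6 (boundary budget U6), unit BB4 (`bb_face_chain`), part 1.

Setting (pure lattice / plane geometry): a finite site set `A ⊆ ℤ²`, a mesh `η > 0` (the mesh point of the site `s`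
is `meshPoint η s = (η s₀, η s₁)`), and a point `p ∈ ℂ`.  The CLOSED `η`-FACE with lower-left corner `g` is the
square `[η g₀, η g₀ + η] × [η g₁, η g₁ + η]` ("`p` lies in the face `g`" is spelled out as four inequalities); its
four CORNERS are `g`, `g + e₀`, `g + e₁`, `g + e₀ + e₁` (`e₀ = ODir.vec 0`, `e₁ = ODir.vec 1`; "`s` is a corner of
`g`" is spelled out as a four-way disjunction).  Assume `A` has NO PINCH (no face whose `A`-corners are exactly a
diagonal pair), and `p` avoids the mesh points of `A`, the closed segments between lattice-adjacent sites of `A`, and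
the closed faces all of whose corners lie in `A`.

Registered stub `bbc_local` (this file): (i) some closed face containing `p` has a corner outside `A`; (ii) any two
non-`A` corners of closed faces containing `p` are joined by a nearest-neighbour walk through such corners;
(iii) every point `p'` close enough to `p` lies only in faces that also contain `p`.  The proof: the faces containing
`p` are the `1`, `2` or `4` faces around `p` (floor of `p / η` coordinatewise, `bbc_line_faces`); all of them share a
common corner outside `A` (`bbc_commonCorner`: a non-`A` corner of the unique face / an endpoint of the lattice edge
through `p` / the lattice point `p` itself), and the non-`A` corners of ONE face are connected among themselves by
the no-pinch hypothesis (`bbc_oneFace`).  Part 2 (`…BBFaceChain`) chains this along a continuous path.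

All statements folklore (elementary geometry of the square grid); no literature fact; nothing restates the crux.
-/

noncomputable section

open Set Metric SimpleGraph
open Literature.Probability.LatticeModels

namespace Summit.CriticalPhenomena.SAWScalingLimit.Theorems.FKGToTraversalBound.SlitNecklace

/-! ### Coordinates -/

/-- Coordinates of a step east. [folklore] -/
@[simp] theorem bbc_add_vec0_apply (g : Site 2) :
    (g + ODir.vec 0) 0 = g 0 + 1 ∧ (g + ODir.vec 0) 1 = g 1 := by
  simp [ODir.vec]

/-- Coordinates of a step north. [folklore] -/
@[simp] theorem bbc_add_vec1_apply (g : Site 2) :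
    (g + ODir.vec 1) 0 = g 0 ∧ (g + ODir.vec 1) 1 = g 1 + 1 := by
  simp [ODir.vec]

/-- Being a corner of the face `g`, in coordinates. [folklore] -/
theorem bbc_corner_iff (s g : Site 2) :
    (s = g ∨ s = g + ODir.vec 0 ∨ s = g + ODir.vec 1 ∨ s = g + ODir.vec 0 + ODir.vec 1) ↔ (s 0 = g 0 ∨ s 0 = g 0 + 1) ∧ (s 1 = g 1 ∨ s 1 = g 1 + 1) := by
  have key : ∀ a b : Site 2, a = b ↔ a 0 = b 0 ∧ a 1 = b 1 := fun a b =>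
    ⟨fun h => by rw [h]; exact ⟨rfl, rfl⟩, fun h => funext fun i => by fin_cases i <;> simp [h.1, h.2]⟩
  have h0 := bbc_add_vec0_apply g
  have h1 := bbc_add_vec1_apply g
  have h2 := bbc_add_vec1_apply (g + ODir.vec 0)
  simp only [key, h0.1, h0.2, h1.1, h1.2, h2.1, h2.2]
  omega

/-! ### One coordinate: the lattice lines `η ℤ` -/

/-- From `η k < η m` (reals, `η > 0`) to `k < m` (integers). [folklore] -/
private theorem bbc_int_lt_of {η : ℝ} (hη : 0 < η) {k m : ℤ} (h : η * (k : ℝ) < η * (m : ℝ)) : k < m := by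
  have : (k : ℝ) < m := lt_of_mul_lt_mul_left h hη.le
  exact_mod_cast this

/-- `η ⌊a / η⌋ ≤ a < η ⌊a / η⌋ + η`. [folklore] -/
theorem bbc_floor_bounds {η : ℝ} (hη : 0 < η) (a : ℝ) :
    η * (⌊a / η⌋ : ℝ) ≤ a ∧ a < η * (⌊a / η⌋ : ℝ) + η := by
  constructor
  · have := Int.floor_le (a / η)
    rw [le_div_iff₀ hη] at this; linarith [mul_comm (⌊a / η⌋ : ℝ) η]
  · have := Int.lt_floor_add_one (a / η)
    rw [div_lt_iff₀ hη] at this; linarith [add_mul (⌊a / η⌋ : ℝ) 1 η]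

/-- The closed `η`-intervals `[η k, η k + η]` containing `a`: `k = ⌊a / η⌋`, or `k = ⌊a / η⌋ - 1` when `a` is the
lattice point `η ⌊a / η⌋`. [folklore] -/
theorem bbc_line_faces {η : ℝ} (hη : 0 < η) (a : ℝ) (k : ℤ) (h1 : η * (k : ℝ) ≤ a) (h2 : a ≤ η * (k : ℝ) + η) :
    k = ⌊a / η⌋ ∨ (k + 1 = ⌊a / η⌋ ∧ a = η * (⌊a / η⌋ : ℝ)) := by
  obtain ⟨h3, h4⟩ := bbc_floor_bounds hη a
  have hk1 : k < ⌊a / η⌋ + 1 := bbc_int_lt_of hη (by push_cast; linarith)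
  have hk2 : ⌊a / η⌋ < k + 2 := bbc_int_lt_of hη (by push_cast; linarith)
  rcases lt_or_eq_of_le (Int.lt_add_one_iff.1 hk1) with hk | hk
  · refine Or.inr ⟨by omega, le_antisymm ?_ h3⟩
    have : ((⌊a / η⌋ : ℤ) : ℝ) = (k : ℝ) + 1 := by
      have : ⌊a / η⌋ = k + 1 := by omega
      rw [this]; push_cast; ring
    rw [this]; linarith
  · exact Or.inl hk

/-- Local finiteness of the lattice lines: every `x` close to `a` lies only in closed `η`-intervals containing `a`.
[folklore] -/
theorem bbc_line_local {η : ℝ} (hη : 0 < η) (a : ℝ) :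
    ∃ ε : ℝ, 0 < ε ∧ ∀ x : ℝ, |x - a| < ε → ∀ k : ℤ, η * (k : ℝ) ≤ x → x ≤ η * (k : ℝ) + η →
      η * (k : ℝ) ≤ a ∧ a ≤ η * (k : ℝ) + η := by
  obtain ⟨h1, h2⟩ := bbc_floor_bounds hη a
  set m : ℤ := ⌊a / η⌋
  by_cases ha : a = η * m
  · refine ⟨η, hη, fun x hx k hk1 hk2 => ?_⟩
    rw [abs_lt] at hx
    have hk3 : k < m + 1 := bbc_int_lt_of hη (by push_cast; linarith)
    have hk4 : m - 2 < k := bbc_int_lt_of hη (by push_cast; linarith)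
    rcases (show k = m ∨ k = m - 1 by omega) with rfl | rfl
    · exact ⟨h1, h2.le⟩
    · push_cast; constructor <;> linarith
  · have ha' : η * m < a := lt_of_le_of_ne h1 (Ne.symm ha)
    refine ⟨min (a - η * m) (η * m + η - a), lt_min (by linarith) (by linarith), fun x hx k hk1 hk2 => ?_⟩
    rw [lt_min_iff, abs_lt, abs_lt] at hx
    have hk3 : k < m + 1 := bbc_int_lt_of hη (by push_cast; linarith)
    have hk4 : m < k + 1 := bbc_int_lt_of hη (by push_cast; linarith)
    obtain rfl : k = m := by omega
    exact ⟨h1, h2.le⟩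

/-! ### Local constancy of the faces through a point -/

/-- (iii) Every point `p'` close enough to `p` lies only in closed `η`-faces that also contain `p`. [folklore] -/
theorem bbc_faces_local {η : ℝ} (hη : 0 < η) (p : ℂ) :
    ∃ ε : ℝ, 0 < ε ∧ ∀ p' : ℂ, dist p' p < ε → ∀ g : Site 2, ((meshPoint η g).re ≤ p'.re ∧ p'.re ≤ (meshPoint η g).re + η ∧ (meshPoint η g).im ≤ p'.im ∧ p'.im ≤ (meshPoint η g).im + η) → ((meshPoint η g).re ≤ p.re ∧ p.re ≤ (meshPoint η g).re + η ∧ (meshPoint η g).im ≤ p.im ∧ p.im ≤ (meshPoint η g).im + η) := by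
  obtain ⟨ε₁, hε₁, h₁⟩ := bbc_line_local hη p.re
  obtain ⟨ε₂, hε₂, h₂⟩ := bbc_line_local hη p.im
  refine ⟨min ε₁ ε₂, lt_min hε₁ hε₂, fun p' hp' g hg => ?_⟩
  rw [lt_min_iff, dist_eq_norm] at hp'
  simp only [meshPoint_re, meshPoint_im] at hg ⊢
  have hre : |p'.re - p.re| < ε₁ := (Complex.abs_re_le_norm (p' - p)).trans_lt hp'.1
  have him : |p'.im - p.im| < ε₂ := (Complex.abs_im_le_norm (p' - p)).trans_lt hp'.2
  obtain ⟨a1, a2⟩ := h₁ p'.re hre (g 0) hg.1 hg.2.1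
  obtain ⟨b1, b2⟩ := h₂ p'.im him (g 1) hg.2.2.1 hg.2.2.2
  exact ⟨a1, a2, b1, b2⟩

/-! ### The non-`A` corners of one face -/

/-- A walk with one-point support. [folklore] -/
private theorem bbc_walk_nil {P : Site 2 → Prop} {a : Site 2} (ha : P a) :
    ∃ w : (zdGraph 2).Walk a a, ∀ z ∈ w.support, P z :=
  ⟨Walk.nil, fun z hz => by
    rw [Walk.support_nil, List.mem_singleton] at hz
    exact hz ▸ ha⟩

/-- A one-step walk. [folklore] -/
private theorem bbc_walk_one {P : Site 2 → Prop} {a b : Site 2} (h : (zdGraph 2).Adj a b) (ha : P a)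
    (hb : P b) : ∃ w : (zdGraph 2).Walk a b, ∀ z ∈ w.support, P z :=
  ⟨Walk.cons h Walk.nil, fun z hz => by
    rw [Walk.support_cons, Walk.support_nil, List.mem_cons, List.mem_singleton] at hz
    rcases hz with rfl | rfl <;> assumption⟩

/-- A two-step walk. [folklore] -/
private theorem bbc_walk_two {P : Site 2 → Prop} {a b c : Site 2} (h : (zdGraph 2).Adj a b)
    (h' : (zdGraph 2).Adj b c) (ha : P a) (hb : P b) (hc : P c) :
    ∃ w : (zdGraph 2).Walk a c, ∀ z ∈ w.support, P z :=
  ⟨Walk.cons h (Walk.cons h' Walk.nil), fun z hz => by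
    rw [Walk.support_cons, Walk.support_cons, Walk.support_nil, List.mem_cons, List.mem_cons,
      List.mem_singleton] at hz
    rcases hz with rfl | rfl | rfl <;> assumption⟩

/-- (one face) Under the no-pinch hypothesis at the face `g` (its `A`-corners are not exactly a diagonal pair),
any two non-`A` corners of `g` are joined by a nearest-neighbour walk through non-`A` corners of `g`: the four
corners form a `4`-cycle, and removing the `A`-corners disconnects it only when they are a diagonal pair. [folklore] -/
theorem bbc_oneFace (A : Finset (Site 2)) (g : Site 2)
    (hp : (g ∈ A → g + ODir.vec 0 + ODir.vec 1 ∈ A → g + ODir.vec 0 ∈ A ∨ g + ODir.vec 1 ∈ A) ∧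
      (g + ODir.vec 0 ∈ A → g + ODir.vec 1 ∈ A → g ∈ A ∨ g + ODir.vec 0 + ODir.vec 1 ∈ A))
    {s s' : Site 2} (hs : (s = g ∨ s = g + ODir.vec 0 ∨ s = g + ODir.vec 1 ∨ s = g + ODir.vec 0 + ODir.vec 1)) (hsA : s ∉ A) (hs' : (s' = g ∨ s' = g + ODir.vec 0 ∨ s' = g + ODir.vec 1 ∨ s' = g + ODir.vec 0 + ODir.vec 1)) (hs'A : s' ∉ A) :
    ∃ w : (zdGraph 2).Walk s s', ∀ z ∈ w.support, (z = g ∨ z = g + ODir.vec 0 ∨ z = g + ODir.vec 1 ∨ z = g + ODir.vec 0 + ODir.vec 1) ∧ z ∉ A := by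
  have e1 : (zdGraph 2).Adj g (g + ODir.vec 0) := ODir.adj_add_vec g 0
  have e2 : (zdGraph 2).Adj g (g + ODir.vec 1) := ODir.adj_add_vec g 1
  have e3 : (zdGraph 2).Adj (g + ODir.vec 0) (g + ODir.vec 0 + ODir.vec 1) := ODir.adj_add_vec _ 1
  have e4 : (zdGraph 2).Adj (g + ODir.vec 1) (g + ODir.vec 0 + ODir.vec 1) := by
    rw [add_right_comm]; exact ODir.adj_add_vec _ 0
  have c1 : (g = g ∨ g = g + ODir.vec 0 ∨ g = g + ODir.vec 1 ∨ g = g + ODir.vec 0 + ODir.vec 1) := Or.inl rfl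
  have c2 : (g + ODir.vec 0 = g ∨ g + ODir.vec 0 = g + ODir.vec 0 ∨ g + ODir.vec 0 = g + ODir.vec 1 ∨ g + ODir.vec 0 = g + ODir.vec 0 + ODir.vec 1) := Or.inr (Or.inl rfl)
  have c3 : (g + ODir.vec 1 = g ∨ g + ODir.vec 1 = g + ODir.vec 0 ∨ g + ODir.vec 1 = g + ODir.vec 1 ∨ g + ODir.vec 1 = g + ODir.vec 0 + ODir.vec 1) := Or.inr (Or.inr (Or.inl rfl))
  have c4 : (g + ODir.vec 0 + ODir.vec 1 = g ∨ g + ODir.vec 0 + ODir.vec 1 = g + ODir.vec 0 ∨ g + ODir.vec 0 + ODir.vec 1 = g + ODir.vec 1 ∨ g + ODir.vec 0 + ODir.vec 1 = g + ODir.vec 0 + ODir.vec 1) :=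
    Or.inr (Or.inr (Or.inr rfl))
  rcases hs.imp Eq.symm id with rfl | rfl | rfl | rfl <;>
    rcases hs'.imp Eq.symm id with rfl | rfl | rfl | rfl
  · exact bbc_walk_nil ⟨c1, hsA⟩
  · exact bbc_walk_one e1 ⟨c1, hsA⟩ ⟨c2, hs'A⟩
  · exact bbc_walk_one e2 ⟨c1, hsA⟩ ⟨c3, hs'A⟩
  · by_cases h : g + ODir.vec 0 ∈ A
    · have h' : g + ODir.vec 1 ∉ A := fun h' => (hp.2 h h').elim hsA hs'A
      exact bbc_walk_two e2 e4 ⟨c1, hsA⟩ ⟨c3, h'⟩ ⟨c4, hs'A⟩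
    · exact bbc_walk_two e1 e3 ⟨c1, hsA⟩ ⟨c2, h⟩ ⟨c4, hs'A⟩
  · exact bbc_walk_one e1.symm ⟨c2, hsA⟩ ⟨c1, hs'A⟩
  · exact bbc_walk_nil ⟨c2, hsA⟩
  · by_cases h : g ∈ A
    · have h' : g + ODir.vec 0 + ODir.vec 1 ∉ A := fun h' => (hp.1 h h').elim hsA hs'A
      exact bbc_walk_two e3 e4.symm ⟨c2, hsA⟩ ⟨c4, h'⟩ ⟨c3, hs'A⟩
    · exact bbc_walk_two e1.symm e2 ⟨c2, hsA⟩ ⟨c1, h⟩ ⟨c3, hs'A⟩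
  · exact bbc_walk_one e3 ⟨c2, hsA⟩ ⟨c4, hs'A⟩
  · exact bbc_walk_one e2.symm ⟨c3, hsA⟩ ⟨c1, hs'A⟩
  · by_cases h : g ∈ A
    · have h' : g + ODir.vec 0 + ODir.vec 1 ∉ A := fun h' => (hp.1 h h').elim hs'A hsA
      exact bbc_walk_two e4 e3.symm ⟨c3, hsA⟩ ⟨c4, h'⟩ ⟨c2, hs'A⟩
    · exact bbc_walk_two e2.symm e1 ⟨c3, hsA⟩ ⟨c1, h⟩ ⟨c2, hs'A⟩
  · exact bbc_walk_nil ⟨c3, hsA⟩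
  · exact bbc_walk_one e4 ⟨c3, hsA⟩ ⟨c4, hs'A⟩
  · by_cases h : g + ODir.vec 0 ∈ A
    · have h' : g + ODir.vec 1 ∉ A := fun h' => (hp.2 h h').elim hs'A hsA
      exact bbc_walk_two e4.symm e2.symm ⟨c4, hsA⟩ ⟨c3, h'⟩ ⟨c1, hs'A⟩
    · exact bbc_walk_two e3.symm e1.symm ⟨c4, hsA⟩ ⟨c2, h⟩ ⟨c1, hs'A⟩
  · exact bbc_walk_one e3.symm ⟨c4, hsA⟩ ⟨c2, hs'A⟩
  · exact bbc_walk_one e4.symm ⟨c4, hsA⟩ ⟨c3, hs'A⟩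
  · exact bbc_walk_nil ⟨c4, hsA⟩

/-! ### A common non-`A` corner of all faces through `p` -/

/-- (common corner) If `p` avoids the mesh points of `A`, the closed segments between lattice-adjacent sites of `A`
and the closed faces with all four corners in `A`, then some site `c ∉ A` is a corner of EVERY closed `η`-face
containing `p`, and of at least one: a non-`A` corner of the unique face if `p` is on no lattice line, a non-`A`
endpoint of the lattice edge through `p` if `p` is on exactly one, the lattice point `p` itself if on two. [folklore] -/
theorem bbc_commonCorner (A : Finset (Site 2)) {η : ℝ} (hη : 0 < η) (p : ℂ)
    (hpt : ∀ f ∈ A, p ≠ meshPoint η f)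
    (hseg : ∀ f ∈ A, ∀ d : ODir, f + d.vec ∈ A → p ∉ segment ℝ (meshPoint η f) (meshPoint η (f + d.vec)))
    (hsq : ∀ f : Site 2, f ∈ A → f + ODir.vec 0 ∈ A → f + ODir.vec 1 ∈ A → f + ODir.vec 0 + ODir.vec 1 ∈ A →
      ¬ ((meshPoint η f).re ≤ p.re ∧ p.re ≤ (meshPoint η f).re + η ∧ (meshPoint η f).im ≤ p.im ∧ p.im ≤ (meshPoint η f).im + η)) :
    ∃ c g₀ : Site 2, c ∉ A ∧ ((meshPoint η g₀).re ≤ p.re ∧ p.re ≤ (meshPoint η g₀).re + η ∧ (meshPoint η g₀).im ≤ p.im ∧ p.im ≤ (meshPoint η g₀).im + η) ∧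
      (c = g₀ ∨ c = g₀ + ODir.vec 0 ∨ c = g₀ + ODir.vec 1 ∨ c = g₀ + ODir.vec 0 + ODir.vec 1) ∧
      ∀ g : Site 2, ((meshPoint η g).re ≤ p.re ∧ p.re ≤ (meshPoint η g).re + η ∧ (meshPoint η g).im ≤ p.im ∧ p.im ≤ (meshPoint η g).im + η) → (c = g ∨ c = g + ODir.vec 0 ∨ c = g + ODir.vec 1 ∨ c = g + ODir.vec 0 + ODir.vec 1) := by
  obtain ⟨hm1, hm2⟩ := bbc_floor_bounds hη p.re
  obtain ⟨hn1, hn2⟩ := bbc_floor_bounds hη p.im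
  set m : ℤ := ⌊p.re / η⌋
  set n : ℤ := ⌊p.im / η⌋
  set g₀ : Site 2 := ![m, n] with hg₀
  have hg₀0 : g₀ 0 = m := by simp [hg₀]
  have hg₀1 : g₀ 1 = n := by simp [hg₀]
  have hIn : ((meshPoint η g₀).re ≤ p.re ∧ p.re ≤ (meshPoint η g₀).re + η ∧ (meshPoint η g₀).im ≤ p.im ∧ p.im ≤ (meshPoint η g₀).im + η) := by
    simp only [meshPoint_re, meshPoint_im, hg₀0, hg₀1]; exact ⟨hm1, hm2.le, hn1, hn2.le⟩
  -- the faces through `p`, in coordinates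
  have hfaces : ∀ g : Site 2, ((meshPoint η g).re ≤ p.re ∧ p.re ≤ (meshPoint η g).re + η ∧ (meshPoint η g).im ≤ p.im ∧ p.im ≤ (meshPoint η g).im + η) →
      (g 0 = m ∨ (g 0 + 1 = m ∧ p.re = η * m)) ∧ (g 1 = n ∨ (g 1 + 1 = n ∧ p.im = η * n)) := by
    intro g hg
    simp only [meshPoint_re, meshPoint_im] at hg
    exact ⟨bbc_line_faces hη p.re (g 0) hg.1 hg.2.1, bbc_line_faces hη p.im (g 1) hg.2.2.1 hg.2.2.2⟩
  -- it suffices to find `c ∉ A` with prescribed coordinates relative to the faces through `p`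
  suffices h : ∃ c : Site 2, c ∉ A ∧ (c = g₀ ∨ c = g₀ + ODir.vec 0 ∨ c = g₀ + ODir.vec 1 ∨ c = g₀ + ODir.vec 0 + ODir.vec 1) ∧
      ∀ g : Site 2, ((meshPoint η g).re ≤ p.re ∧ p.re ≤ (meshPoint η g).re + η ∧ (meshPoint η g).im ≤ p.im ∧ p.im ≤ (meshPoint η g).im + η) → (c 0 = g 0 ∨ c 0 = g 0 + 1) ∧ (c 1 = g 1 ∨ c 1 = g 1 + 1) by
    obtain ⟨c, h1, h2, h3⟩ := h
    exact ⟨c, g₀, h1, hIn, h2, fun g hg => (bbc_corner_iff c g).2 (h3 g hg)⟩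
  have v0 := bbc_add_vec0_apply g₀
  have v1 := bbc_add_vec1_apply g₀
  by_cases hre : p.re = η * m <;> by_cases him : p.im = η * n
  · -- `p` is the lattice point `meshPoint η g₀`
    have hc : g₀ ∉ A := fun h => hpt g₀ h (Complex.ext (by simp [hg₀0, hre]) (by simp [hg₀1, him]))
    refine ⟨g₀, hc, Or.inl rfl, fun g hg => ?_⟩
    obtain ⟨h0, h1⟩ := hfaces g hg
    have h0' : g 0 = m ∨ g 0 + 1 = m := h0.imp_right And.left
    have h1' : g 1 = n ∨ g 1 + 1 = n := h1.imp_right And.left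
    omega
  · -- `p` lies on the vertical lattice edge from `g₀` to `g₀ + e₁`, not at an endpoint
    have hmem : p ∈ segment ℝ (meshPoint η g₀) (meshPoint η (g₀ + ODir.vec 1)) := by
      refine ⟨1 - (p.im / η - n), p.im / η - n, ?_, ?_, by ring, ?_⟩
      · rw [sub_nonneg, sub_le_iff_le_add, div_le_iff₀ hη]; linarith
      · rw [sub_nonneg, le_div_iff₀ hη]; linarith
      · apply Complex.ext
        · simp only [Complex.add_re, Complex.smul_re, smul_eq_mul, meshPoint_re, v1.1, hg₀0, hre]; ring
        · simp only [Complex.add_im, Complex.smul_im, smul_eq_mul, meshPoint_im, v1.2, hg₀1]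
          push_cast; field_simp; ring
    have hc : ¬ (g₀ ∈ A ∧ g₀ + ODir.vec 1 ∈ A) := fun h => hseg g₀ h.1 1 h.2 hmem
    obtain ⟨c, hcA, hc0, hc1, hcor⟩ : ∃ c : Site 2, c ∉ A ∧ c 0 = m ∧ (c 1 = n ∨ c 1 = n + 1) ∧
        (c = g₀ ∨ c = g₀ + ODir.vec 0 ∨ c = g₀ + ODir.vec 1 ∨ c = g₀ + ODir.vec 0 + ODir.vec 1) := by
      by_cases h : g₀ ∈ A
      · exact ⟨g₀ + ODir.vec 1, fun h' => hc ⟨h, h'⟩, by rw [v1.1, hg₀0], Or.inr (by rw [v1.2, hg₀1]),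
          Or.inr (Or.inr (Or.inl rfl))⟩
      · exact ⟨g₀, h, hg₀0, Or.inl hg₀1, Or.inl rfl⟩
    refine ⟨c, hcA, hcor, fun g hg => ?_⟩
    obtain ⟨h0, h1⟩ := hfaces g hg
    have h0' : g 0 = m ∨ g 0 + 1 = m := h0.imp_right And.left
    have h1' : g 1 = n := h1.elim id (fun h => absurd h.2 him)
    omega
  · -- `p` lies on the horizontal lattice edge from `g₀` to `g₀ + e₀`, not at an endpoint
    have hmem : p ∈ segment ℝ (meshPoint η g₀) (meshPoint η (g₀ + ODir.vec 0)) := by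
      refine ⟨1 - (p.re / η - m), p.re / η - m, ?_, ?_, by ring, ?_⟩
      · rw [sub_nonneg, sub_le_iff_le_add, div_le_iff₀ hη]; linarith
      · rw [sub_nonneg, le_div_iff₀ hη]; linarith
      · apply Complex.ext
        · simp only [Complex.add_re, Complex.smul_re, smul_eq_mul, meshPoint_re, v0.1, hg₀0]
          push_cast; field_simp; ring
        · simp only [Complex.add_im, Complex.smul_im, smul_eq_mul, meshPoint_im, v0.2, hg₀1, him]; ring
    have hc : ¬ (g₀ ∈ A ∧ g₀ + ODir.vec 0 ∈ A) := fun h => hseg g₀ h.1 0 h.2 hmem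
    obtain ⟨c, hcA, hc0, hc1, hcor⟩ : ∃ c : Site 2, c ∉ A ∧ (c 0 = m ∨ c 0 = m + 1) ∧ c 1 = n ∧
        (c = g₀ ∨ c = g₀ + ODir.vec 0 ∨ c = g₀ + ODir.vec 1 ∨ c = g₀ + ODir.vec 0 + ODir.vec 1) := by
      by_cases h : g₀ ∈ A
      · exact ⟨g₀ + ODir.vec 0, fun h' => hc ⟨h, h'⟩, Or.inr (by rw [v0.1, hg₀0]), by rw [v0.2, hg₀1],
          Or.inr (Or.inl rfl)⟩
      · exact ⟨g₀, h, Or.inl hg₀0, hg₀1, Or.inl rfl⟩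
    refine ⟨c, hcA, hcor, fun g hg => ?_⟩
    obtain ⟨h0, h1⟩ := hfaces g hg
    have h0' : g 0 = m := h0.elim id (fun h => absurd h.2 hre)
    have h1' : g 1 = n ∨ g 1 + 1 = n := h1.imp_right And.left
    omega
  · -- `p` is interior to the face `g₀`
    have hc : ¬ (g₀ ∈ A ∧ g₀ + ODir.vec 0 ∈ A ∧ g₀ + ODir.vec 1 ∈ A ∧ g₀ + ODir.vec 0 + ODir.vec 1 ∈ A) :=
      fun h => hsq g₀ h.1 h.2.1 h.2.2.1 h.2.2.2 hIn
    obtain ⟨c, hcA, hcor⟩ : ∃ c : Site 2, c ∉ A ∧ (c = g₀ ∨ c = g₀ + ODir.vec 0 ∨ c = g₀ + ODir.vec 1 ∨ c = g₀ + ODir.vec 0 + ODir.vec 1) := by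
      by_cases h1 : g₀ ∈ A
      · by_cases h2 : g₀ + ODir.vec 0 ∈ A
        · by_cases h3 : g₀ + ODir.vec 1 ∈ A
          · exact ⟨_, fun h4 => hc ⟨h1, h2, h3, h4⟩, Or.inr (Or.inr (Or.inr rfl))⟩
          · exact ⟨_, h3, Or.inr (Or.inr (Or.inl rfl))⟩
        · exact ⟨_, h2, Or.inr (Or.inl rfl)⟩
      · exact ⟨_, h1, Or.inl rfl⟩
    refine ⟨c, hcA, hcor, fun g hg => ?_⟩
    obtain ⟨h0, h1⟩ := hfaces g hg
    have h0' : g 0 = m := h0.elim id (fun h => absurd h.2 hre)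
    have h1' : g 1 = n := h1.elim id (fun h => absurd h.2 him)
    have hc' := (bbc_corner_iff c g₀).1 hcor
    omega

/-! ### The registered local lemma -/

/-- **Registered stub `bbc_local` (U6 BB4, part 1: the local lemma of the face-chain discretisation).**  Let
`A ⊆ ℤ²` be finite with no pinch, `η > 0`, and let the point `p` avoid the mesh points of `A`, the closed segments
between lattice-adjacent sites of `A` and the closed `η`-faces with all four corners in `A`.  Then (i) some closed
`η`-face containing `p` has a corner outside `A`; (ii) any two non-`A` corners of closed faces containing `p` are
joined by a nearest-neighbour walk all of whose sites are non-`A` corners of closed faces containing `p`;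
(iii) there is `ε > 0` such that every `p'` with `dist p' p < ε` lies only in closed faces containing `p`. [folklore] -/
theorem bbc_local : ∀ (A : Finset (Site 2)) (η : ℝ) (p : ℂ), 0 < η → (∀ f : Site 2, (f ∈ A → f + ODir.vec 0 + ODir.vec 1 ∈ A → f + ODir.vec 0 ∈ A ∨ f + ODir.vec 1 ∈ A) ∧ (f + ODir.vec 0 ∈ A → f + ODir.vec 1 ∈ A → f ∈ A ∨ f + ODir.vec 0 + ODir.vec 1 ∈ A)) → (∀ f ∈ A, p ≠ meshPoint η f) → (∀ f ∈ A, ∀ d : ODir, f + d.vec ∈ A → p ∉ segment ℝ (meshPoint η f) (meshPoint η (f + d.vec))) → (∀ f : Site 2, f ∈ A → f + ODir.vec 0 ∈ A → f + ODir.vec 1 ∈ A → f + ODir.vec 0 + ODir.vec 1 ∈ A → ¬ ((meshPoint η f).re ≤ p.re ∧ p.re ≤ (meshPoint η f).re + η ∧ (meshPoint η f).im ≤ p.im ∧ p.im ≤ (meshPoint η f).im + η)) → (∃ (g s : Site 2), ((meshPoint η g).re ≤ p.re ∧ p.re ≤ (meshPoint η g).re + η ∧ (meshPoint η g).im ≤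 p.im ∧ p.im ≤ (meshPoint η g).im + η) ∧ (s = g ∨ s = g + ODir.vec 0 ∨ s = g + ODir.vec 1 ∨ s = g + ODir.vec 0 + ODir.vec 1) ∧ s ∉ A) ∧ (∀ (g s g' s' : Site 2), ((meshPoint η g).re ≤ p.re ∧ p.re ≤ (meshPoint η g).re + η ∧ (meshPoint η g).im ≤ p.im ∧ p.im ≤ (meshPoint η g).im + η) → (s = g ∨ s = g + ODir.vec 0 ∨ s = g + ODir.vec 1 ∨ s = g + ODir.vec 0 + ODir.vec 1) → s ∉ A → ((meshPoint η g').re ≤ p.re ∧ p.re ≤ (meshPoint η g').re + η ∧ (meshPoint η g').im ≤ p.im ∧ p.im ≤ (meshPoint η g').im + η) → (s' = g' ∨ s' = g' + ODir.vec 0 ∨ s' = g' + ODir.vec 1 ∨ s' = g' + ODir.vec 0 + ODir.vec 1) → s' ∉ A → ∃ w : (zdGraph 2).Walk s s', ∀ z ∈ w.support, z ∉ A ∧ ∃ g'' : Site 2, ((meshPoint η g'').re ≤ p.re ∧ p.re ≤ (meshPoint η g'').re + η ∧ (meshPoint η g'').im ≤ p.im ∧ p.im ≤ (meshPoint η g'').im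 + η) ∧ (z = g'' ∨ z = g'' + ODir.vec 0 ∨ z = g'' + ODir.vec 1 ∨ z = g'' + ODir.vec 0 + ODir.vec 1)) ∧ (∃ ε : ℝ, 0 < ε ∧ ∀ p' : ℂ, dist p' p < ε → ∀ g : Site 2, ((meshPoint η g).re ≤ p'.re ∧ p'.re ≤ (meshPoint η g).re + η ∧ (meshPoint η g).im ≤ p'.im ∧ p'.im ≤ (meshPoint η g).im + η) → ((meshPoint η g).re ≤ p.re ∧ p.re ≤ (meshPoint η g).re + η ∧ (meshPoint η g).im ≤ p.im ∧ p.im ≤ (meshPoint η g).im + η)) := by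
  intro A η p hη hpinch hpt hseg hsq
  obtain ⟨c, g₀, hcA, hg₀, hcg₀, hall⟩ := bbc_commonCorner A hη p hpt hseg hsq
  refine ⟨⟨g₀, c, hg₀, hcg₀, hcA⟩, fun g s g' s' hg hs hsA hg' hs' hs'A => ?_, bbc_faces_local hη p⟩
  obtain ⟨w₁, hw₁⟩ := bbc_oneFace A g (hpinch g) hs hsA (hall g hg) hcA
  obtain ⟨w₂, hw₂⟩ := bbc_oneFace A g' (hpinch g') (hall g' hg') hcA hs' hs'A
  refine ⟨w₁.append w₂, fun z hz => ?_⟩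
  rcases (Walk.mem_support_append_iff _ _).1 hz with hz | hz
  · exact ⟨(hw₁ z hz).2, g, hg, (hw₁ z hz).1⟩
  · exact ⟨(hw₂ z hz).2, g', hg', (hw₂ z hz).1⟩

end Summit.CriticalPhenomena.SAWScalingLimit.Theorems.FKGToTraversalBound.SlitNecklace

end
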